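import Summits.BirchSwinnertonDyer.BirchSwinnertonDyer.Theorems.SignedLowerHalvesSmallImageLowerHalfBothSignsRttD2SpecialisationDefs
import Summits.BirchSwinnertonDyer.BirchSwinnertonDyer.Theorems.SignedLowerHalvesSmallImageLowerHalfBothSignsRttD2LambdaSpecialisationO
import Literature.NumberTheory.EllipticCurves.SharpFlatPAdicLFunctionCoeffField
import HarnessLib

/-!
# Route `SignedLowerHalves`, crux L `SmallImageLowerHalfBothSigns` (item stmt-BirchSwinnertonDyer-23599), line `rtt_w3` v13 — E2, row D2: PINS — the through-`φ`
# structures of `…RttD2SpecialisationDefs` satisfy the hypotheses `l • x = (ι l) • x` / `r • x = (ι (ι₀ r)) • x` of `…RttD2SpecialisationHK[Cyclic]`,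
# and the cyclic-zeta hypothesis `(D.Z).map mk = R∙z` from `D.Z = R∙w`

Width seat `bsd-line-slh-p3-w3` g19 under LEAD `cruxlead-stmt-BirchSwinnertonDyer-23599` g9 (D2 DEFINER); ROUTE-INDEPENDENT helper (`--supports
stmt-BirchSwinnertonDyer-23599`); THEOREMS ONLY — no definition, no named fact, no instance, no `sorry`; closes nothing; BSD is not proved by any of this.

For `φ : 𝒪⟦T₂⟧⟦T₁⟧ →+* 𝒪⟦T⟧` with `φ (C (C a)) = C a`, `φ X = X` (`𝒪` any commutative ring) and `ι = PowerSeries.map C`: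
* `moduleThrough_smul_eq_map_smul` / ★ `moduleQuotSMulTop_smul_eq_map_smul` / `moduleTorsionBy_smul_eq_map_smul` — under the through-`φ` structure
  (`SmallImageRttD2Spec.moduleThrough …`, `ker φ = (f)`): `l • x = (ι l) • x` — the pin `hιH` of `lambdaInvariant_quotient_span_singleton_le_of_thm52Shape`.
* `smul_eq_map_smul_of_isScalarTower` — in the glue's context (`[Algebra Λ Λ_𝒪]`, `halg`, `[IsScalarTower Λ Λ_𝒪 Y]`) an `ι`-pinned `Λ_𝒪`-structure gives the
  `Λ`-pin `r • x = (ι (iwasawaToIwasawaO S r)) • x` (the hypothesis `hΛ2`).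
* `map_mkQ_eq_span_singleton_of_eq_span_singleton` / `map_mkQ_Z_eq_span_zetaSp_of_Z_eq_cyclic` — `(D.Z).map mk = R∙(mk w)` when `D.Z = R∙w`, in particular
  `= R∙(zetaSp f D a)` when `D.Z = D.cyclic a` (the hypothesis `hz`).

References: [JohnsonLeungKings2011] §4.2 (Def. 4.2, Lemma 4.4), §5.2; [BourbakiAC5to7] VII §4.5.
-/

set_option autoImplicit false
-- the Theorems namespace of this sub repeats the summit name by design (D-0017 nested layout)
set_option linter.dupNamespace false

noncomputable section

open scoped Pointwise
open PowerSeries Literature.NumberTheory.Automorphic Literature.NumberTheory.EllipticCurves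
open Literature.NumberTheory.ComplexMultiplication.EllipticUnits.JohnsonLeungKings2011

namespace Summit.BirchSwinnertonDyer.BirchSwinnertonDyer.Theorems.SmallImageRttD2Spec

universe u v w

section Clauses

variable {A : Type u} [CommRing A] (φ : PowerSeries (PowerSeries A) →+* PowerSeries A)
  (hC : ∀ a : A, φ (C (C a)) = C a) (hX : φ X = X)

-- `φ` is surjective: `fun l ↦ ⟨PowerSeries.map C l, SmallImageRttD2LamSpec.map_outer_eq_self_of_clauses' φ hC hX l⟩` (the `hφ` below).

variable (hφ : Function.Surjective φ) (f : PowerSeries (PowerSeries A)) (hker : RingHom.ker φ = Ideal.span {f})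

include hC hX in
/-- **Through-`φ` = restriction along `ι` (pointwise):** under `moduleThrough φ hφ f hker M hM`, `l • m = (ι l) • m`. [cite: JohnsonLeungKings2011, §4.2 Def. 4.2] -/
theorem moduleThrough_smul_eq_map_smul (M : Type v) [AddCommGroup M] [Module (PowerSeries (PowerSeries A)) M] (hM : ∀ m : M, f • m = 0)
    (l : PowerSeries A) (m : M) :
    @HSMul.hSMul (PowerSeries A) M M (@instHSMul (PowerSeries A) M (moduleThrough φ hφ f hker M hM).toSMul) l m =
      (PowerSeries.map (PowerSeries.C : A →+* PowerSeries A) l) • m := by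
  conv_lhs => rw [← SmallImageRttD2LamSpec.map_outer_eq_self_of_clauses' φ hC hX l]
  exact moduleThrough_smul φ hφ f hker M hM _ m

include hC hX in
/-- ★ **The pin `hιH` for `Hsp = M ⧸ fM` with the through-`φ` structure:** `l • x = (ι l) • x`. [cite: JohnsonLeungKings2011, §4.2 Def. 4.2] -/
theorem moduleQuotSMulTop_smul_eq_map_smul (M : Type v) [AddCommGroup M] [Module (PowerSeries (PowerSeries A)) M]
    (l : PowerSeries A) (x : QuotSMulTop f M) :
    @HSMul.hSMul (PowerSeries A) _ _ (@instHSMul (PowerSeries A) _ (moduleQuotSMulTop φ hφ f hker M).toSMul) l x =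
      (PowerSeries.map (PowerSeries.C : A →+* PowerSeries A) l) • x :=
  moduleThrough_smul_eq_map_smul φ hC hX hφ f hker _ (smul_quotSMulTop_eq_zero f M) l x

include hC hX in
/-- The pin for `M[f]` with the through-`φ` structure: `l • x = (ι l) • x`. [cite: JohnsonLeungKings2011, §4.2 Def. 4.2] -/
theorem moduleTorsionBy_smul_eq_map_smul (M : Type v) [AddCommGroup M] [Module (PowerSeries (PowerSeries A)) M]
    (l : PowerSeries A) (x : Submodule.torsionBy (PowerSeries (PowerSeries A)) M f) :
    @HSMul.hSMul (PowerSeries A) _ _ (@instHSMul (PowerSeries A) _ (moduleTorsionBy φ hφ f hker M).toSMul) l x =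
      (PowerSeries.map (PowerSeries.C : A →+* PowerSeries A) l) • x :=
  moduleThrough_smul_eq_map_smul φ hC hX hφ f hker _ (smul_torsionBy_eq_zero f M) l x

end Clauses

section GluePin

variable (p : ℕ) [Fact p.Prime] (S : Set (PadicAlgCl p))

/-- **The `Λ`-pin from the glue's tower.** For a module `Y` over `R = PowerSeries (IwasawaAlgebraO S)` with a `Λ_𝒪`-structure pinned by
`l • y = (ι l) • y`, the glue's `[Algebra Λ Λ_𝒪]` (`algebraMap = iwasawaToIwasawaO S`) and `[Module Λ Y] [IsScalarTower Λ Λ_𝒪 Y]`: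
`r • y = (ι (iwasawaToIwasawaO S r)) • y` (the hypothesis `hΛ2` of `…RttD2SpecialisationHK`). [folklore] -/
theorem smul_eq_map_smul_of_isScalarTower (Y : Type v) [AddCommGroup Y] [Module (PowerSeries (IwasawaAlgebraO S)) Y]
    [Module (IwasawaAlgebraO S) Y]
    (hι : ∀ (l : IwasawaAlgebraO S) (y : Y), l • y = (PowerSeries.map (PowerSeries.C : padicCoeffIntegers S →+* IwasawaAlgebraO S) l) • y)
    [Algebra (IwasawaAlgebra p) (IwasawaAlgebraO S)]
    (halg : ∀ r : IwasawaAlgebra p, algebraMap (IwasawaAlgebra p) (IwasawaAlgebraO S) r = iwasawaToIwasawaO S r)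
    [Module (IwasawaAlgebra p) Y] [IsScalarTower (IwasawaAlgebra p) (IwasawaAlgebraO S) Y] (r : IwasawaAlgebra p) (y : Y) :
    r • y = (PowerSeries.map (PowerSeries.C : padicCoeffIntegers S →+* IwasawaAlgebraO S) (iwasawaToIwasawaO S r)) • y := by
  rw [← IsScalarTower.algebraMap_smul (IwasawaAlgebraO S) r y, halg, hι]

end GluePin

section Cyclic

variable {R : Type u} [CommRing R] (f : R) {Aidx H0 H1 H2 : Type v} [AddCommGroup H0] [Module R H0] [AddCommGroup H1] [Module R H1]
  [AddCommGroup H2] [Module R H2] (D : ZetaSkeleton R Aidx H0 H1 H2)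

/-- `Z̄ = R∙(mk w)` when `Z = R∙w`. [cite: JohnsonLeungKings2011, §5.2] -/
theorem map_mkQ_eq_span_singleton_of_eq_span_singleton {Z : Submodule R H1} {w : H1} (h : Z = Submodule.span R {w}) :
    Z.map (f • (⊤ : Submodule R H1)).mkQ = Submodule.span R {(Submodule.Quotient.mk w : QuotSMulTop f H1)} := by
  rw [h, Submodule.map_span, Set.image_singleton]
  rfl

/-- **The hypothesis `hz` from a cyclic zeta module:** if `D.Z = D.cyclic a` (one auxiliary `𝔞` generates `𝒥(ζ)`), then
`(D.Z).map mk = R∙(zetaSp f D a)`. [cite: JohnsonLeungKings2011, §5.2 and §6.1] -/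
theorem map_mkQ_Z_eq_span_zetaSp_of_Z_eq_cyclic (a : Aidx) (h : D.Z = D.cyclic a) :
    (D.Z).map (f • (⊤ : Submodule R H1)).mkQ = Submodule.span R {zetaSp f D a} :=
  map_mkQ_eq_span_singleton_of_eq_span_singleton f h

end Cyclic

end Summit.BirchSwinnertonDyer.BirchSwinnertonDyer.Theorems.SmallImageRttD2Spec

end
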